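import Summits.QuantumFields.YangMills.Theorems.SoloInformedNonFreezingFloor
import HarnessLib
import HarnessLib.Audit.Tags

/-!
# QuantumFields / YangMills — non-freezing from a floor at POLY-LOGARITHMIC separation
(solo seat `solo-QuantumFields-informed`, session 9)

Fourth kernel file of the non-freezing rung.  `SoloInformedNonFreezingFloor.lean` reduced
`LatticeNonFreezing` to a polynomial floor `c β^{−p}` on one plaquette pair correlation at POLYNOMIAL
separation `n ≥ β^{1/k}`.  Session 9 observed that the node `LatticeNonFreezing` — "no `(C, μ > 0)` clusters
the plaquette field at all large `β` on all large tori" — needs much less: a floor `c β^{−p}` at any separation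
`n` with `n / log β → ∞`, e.g. `(log β)² ≤ a·n`, already beats every fixed exponential
(`C e^{−μ n} β^{p} ≤ C exp(p √(a n) − μ n) → 0`).  Consequence for the seat's analytic programme
(paper/nonfreezing.md v2.4 §0.4, "robust regime"): the clean box may be taken of poly-LOGARITHMIC side
(`ℓ = ⌈(log β)²⌉`, `ℓ′ = ℓ^C`, cleanliness threshold `t² = K log β / β`), and then every condition of the
error budget that compares powers of `β` holds with margin `≈ 1/2` in the exponent; only the two profile-geometry
conditions (`C > 11/2`, `2d(C−1) > 9`) remain.  The sharper polynomial-scale statement (Theorem A′, scales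
`ℓ ≤ β^ε`) is not needed for non-freezing.

Contents (sorry-free, no facts):
* `exists_nat_exp_sqrt_sub_lt` — `C · exp(b √n − μ n) < c` for all large `n` (`μ, c > 0`, `b ≥ 0`);
* `LogFloorWitness` — the node: a pair at separation `(log β)² ≤ a·n` with `c ≤ β^p |⟨P₀ ; P_{(n,y)}⟩|`;
* `SmearedLogFloorWitness` — the assembled form (finite weighted sum) and `logFloorWitness_of_smearedLog`
  (pigeonhole, reusing `exists_lt_abs_of_lt_abs_sum`);
* `latticeNonFreezing_of_logFloor`, `latticeNonFreezing_of_smearedLogFloor`;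
* `logFloorWitness_of_polynomialFloor` — the polynomial-separation node of session 6 implies this one
  (`log β ≤ k log n ≤ 2k √n`), so the new criterion is the stronger of the two.

Informal companion: the seat's `paper/nonfreezing.md` v2.4 §0.4.
-/

open MeasureTheory Filter Topology
open Literature.MathematicalPhysics.AQFT Literature.MathematicalPhysics.QuantumLattice
open Literature.MathematicalPhysics.QuantumFieldTheory Literature.Probability.LatticeModels

noncomputable section

namespace Summit.QuantumFields.YangMills.Theorems

/-! ### An exponential with a square-root gain is eventually small -/

/-- For `μ > 0`, `c > 0`, `b ≥ 0` and any real `C`: `C · exp(b √n − μ n) < c` for all large natural `n`. -/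
theorem exists_nat_exp_sqrt_sub_lt (C b μ c : ℝ) (hb : 0 ≤ b) (hμ : 0 < μ) (hc : 0 < c) :
    ∃ N₀ : ℕ, ∀ n : ℕ, N₀ ≤ n → C * Real.exp (b * Real.sqrt n - μ * n) < c := by
  rcases le_or_gt C 0 with hC | hC
  · refine ⟨0, fun n _ => ?_⟩
    have h1 : C * Real.exp (b * Real.sqrt n - μ * n) ≤ 0 :=
      mul_nonpos_of_nonpos_of_nonneg hC (Real.exp_pos _).le
    exact lt_of_le_of_lt h1 hc
  · -- `C e^{-(μ/2) n} < c` eventually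
    obtain ⟨N₁, hN₁⟩ := exists_nat_pow_mul_exp_neg_lt C (μ / 2) c (half_pos hμ) hc 0
    -- `b √n ≤ (μ/2) n` once `√n ≥ 2b/μ`
    refine ⟨max N₁ (Nat.ceil ((2 * b / μ) ^ 2)), fun n hn => ?_⟩
    have hn1 : N₁ ≤ n := le_trans (le_max_left _ _) hn
    have hn2 : (2 * b / μ) ^ 2 ≤ (n : ℝ) := by
      have : (Nat.ceil ((2 * b / μ) ^ 2) : ℝ) ≤ n := by exact_mod_cast le_trans (le_max_right _ _) hn
      exact le_trans (Nat.le_ceil _) this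
    have hnn : (0 : ℝ) ≤ n := Nat.cast_nonneg n
    have hsq : 2 * b / μ ≤ Real.sqrt n := by
      have h0 : 0 ≤ 2 * b / μ := by positivity
      calc 2 * b / μ = Real.sqrt ((2 * b / μ) ^ 2) := by rw [Real.sqrt_sq h0]
        _ ≤ Real.sqrt n := Real.sqrt_le_sqrt hn2
    have hb' : b ≤ μ / 2 * Real.sqrt n := by
      have := mul_le_mul_of_nonneg_left hsq (le_of_lt (half_pos hμ))
      calc b = μ / 2 * (2 * b / μ) := by field_simp
        _ ≤ μ / 2 * Real.sqrt n := this
    have hexp : b * Real.sqrt n - μ * n ≤ -(μ / 2 * n) := by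
      have h1 : b * Real.sqrt n ≤ μ / 2 * Real.sqrt n * Real.sqrt n :=
        mul_le_mul_of_nonneg_right hb' (Real.sqrt_nonneg _)
      have h2 : Real.sqrt n * Real.sqrt n = n := Real.mul_self_sqrt hnn
      have h3 : b * Real.sqrt n ≤ μ / 2 * n := by
        calc b * Real.sqrt n ≤ μ / 2 * Real.sqrt n * Real.sqrt n := h1
          _ = μ / 2 * (Real.sqrt n * Real.sqrt n) := by ring
          _ = μ / 2 * n := by rw [h2]
      linarith
    have h4 : C * Real.exp (b * Real.sqrt n - μ * n) ≤ C * Real.exp (-(μ / 2 * n)) :=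
      mul_le_mul_of_nonneg_left (Real.exp_le_exp.mpr hexp) hC.le
    have h5 : C * ((n : ℝ) ^ 0) * Real.exp (-(μ / 2 * n)) < c := hN₁ n hn1
    rw [pow_zero, mul_one] at h5
    exact lt_of_le_of_lt h4 h5

/-! ### The nodes -/

/-- **Floor at poly-logarithmic separation.** Per compact simple `G` and representation `r`: there are
`p : ℕ`, `a > 0` and `c > 0` such that for all large `β`, on EVERY large torus of side `2S+1`, some plaquette
pair — `P = r.curvature` at the origin and its translate by `n ≤ S` in time, `y` in space — with
`(log β)² ≤ a·n` has `β^p · |⟨P₀ ; P_{(n,y)}⟩_{β,S}| ≥ c`.  (Intended: `n ≍ ℓ = ⌈(log β)²⌉`, `p = 2 + o(1)`;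
paper/nonfreezing.md v2.4 §0.4, the robust regime.) [conjecture: the seat's analytic target, weakest
separation form] -/
@[conjecture] def LogFloorWitness : Prop :=
  ∀ (G : Type) [Group G] [TopologicalSpace G] [IsTopologicalGroup G] [CompactSpace G],
    IsCompactSimpleLieGroup G →
      letI : MeasurableSpace G := borel G
      haveI : BorelSpace G := ⟨rfl⟩
      ∀ (r : LatticeRep G), ∃ (p : ℕ) (a c : ℝ), 0 < a ∧ 0 < c ∧
        ∃ β₁ : ℝ, ∀ β : ℝ, β₁ ≤ β → ∃ S₁ : ℕ, ∀ S : ℕ, S₁ ≤ S →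
          ∃ (n : ℕ) (y : Site 4), Real.log β ^ 2 ≤ a * n ∧ n ≤ S ∧ y 0 = 0 ∧
            c ≤ β ^ p * |latticeConnectedCorr r.ρ β (2 * S + 1) r.curvature.F
                (fun U => r.curvature.F (configShift (-y) U)) n|

/-- **Smeared floor at poly-logarithmic separation** (the assembled form the clean-box analysis delivers: a finite
weighted sum of pair correlations over displacements with `(log β)² ≤ a·n`, exceeding `c β^{−p} ∑|W|` in
modulus). [conjecture: the seat's analytic target in assembled form, robust regime] -/
@[conjecture] def SmearedLogFloorWitness : Prop :=
  ∀ (G : Type) [Group G] [TopologicalSpace G] [IsTopologicalGroup G] [CompactSpace G],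
    IsCompactSimpleLieGroup G →
      letI : MeasurableSpace G := borel G
      haveI : BorelSpace G := ⟨rfl⟩
      ∀ (r : LatticeRep G), ∃ (p : ℕ) (a c : ℝ), 0 < a ∧ 0 < c ∧
        ∃ β₁ : ℝ, ∀ β : ℝ, β₁ ≤ β → ∃ S₁ : ℕ, ∀ S : ℕ, S₁ ≤ S →
          ∃ (s : Finset (ℕ × Site 4)) (W : ℕ × Site 4 → ℝ),
            (∀ d ∈ s, Real.log β ^ 2 ≤ a * d.1 ∧ d.1 ≤ S ∧ d.2 0 = 0) ∧
            c * (β ^ p)⁻¹ * (∑ d ∈ s, |W d|) <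
              |∑ d ∈ s, W d * latticeConnectedCorr r.ρ β (2 * S + 1) r.curvature.F
                  (fun U => r.curvature.F (configShift (-d.2) U)) d.1|

/-! ### Pigeonhole -/

/-- **Pigeonhole.** A smeared log-floor forces a log-floor (same `p, a, c`, for `β ≥ max β₁ 1`). -/
theorem logFloorWitness_of_smearedLog (hW : SmearedLogFloorWitness) : LogFloorWitness := by
  intro G _ _ _ _ hG
  letI : MeasurableSpace G := borel G
  haveI : BorelSpace G := ⟨rfl⟩
  intro r
  obtain ⟨p, a, c, ha, hc, β₁, hβ₁⟩ := hW G hG r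
  refine ⟨p, a, c, ha, hc, max β₁ 1, fun β hβ => ?_⟩
  have hβ₁' : β₁ ≤ β := le_trans (le_max_left _ _) hβ
  have hβpos : 0 < β := lt_of_lt_of_le one_pos (le_trans (le_max_right _ _) hβ)
  obtain ⟨S₁, hS₁⟩ := hβ₁ β hβ₁'
  refine ⟨S₁, fun S hS => ?_⟩
  obtain ⟨s, W, hsW, hsum⟩ := hS₁ S hS
  obtain ⟨d, hd, hlt⟩ := exists_lt_abs_of_lt_abs_sum s W
    (fun d => latticeConnectedCorr r.ρ β (2 * S + 1) r.curvature.F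
      (fun U => r.curvature.F (configShift (-d.2) U)) d.1) (c * (β ^ p)⁻¹) hsum
  obtain ⟨hsep, hdS, hdy⟩ := hsW d hd
  refine ⟨d.1, d.2, hsep, hdS, hdy, ?_⟩
  have hβp : 0 < β ^ p := pow_pos hβpos p
  have := (mul_lt_mul_of_pos_left hlt hβp).le
  rwa [← mul_assoc, mul_comm (β ^ p) c, mul_assoc, mul_inv_cancel₀ hβp.ne', mul_one] at this

/-! ### Log-floor ⇒ non-freezing -/

/-- `β ≥ 1` and `(log β)² ≤ a n` give `β^p ≤ exp(p √a · √n)`. -/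
theorem pow_le_exp_sqrt {β a : ℝ} {n p : ℕ} (hβ : 1 ≤ β) (ha : 0 ≤ a)
    (hsep : Real.log β ^ 2 ≤ a * n) :
    β ^ p ≤ Real.exp ((p : ℝ) * Real.sqrt a * Real.sqrt n) := by
  have hβpos : 0 < β := lt_of_lt_of_le one_pos hβ
  have hlog : Real.log β ≤ Real.sqrt a * Real.sqrt n := by
    have h1 : |Real.log β| ≤ Real.sqrt (a * n) := Real.abs_le_sqrt hsep
    have h2 : Real.sqrt (a * n) = Real.sqrt a * Real.sqrt n := Real.sqrt_mul ha _
    exact le_trans (le_abs_self _) (h2 ▸ h1)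
  have h3 : β ^ p = Real.exp ((p : ℝ) * Real.log β) := by
    rw [Real.exp_nat_mul, Real.exp_log hβpos]
  rw [h3]
  apply Real.exp_le_exp.mpr
  have hp : (0 : ℝ) ≤ p := Nat.cast_nonneg p
  calc (p : ℝ) * Real.log β ≤ (p : ℝ) * (Real.sqrt a * Real.sqrt n) := mul_le_mul_of_nonneg_left hlog hp
    _ = (p : ℝ) * Real.sqrt a * Real.sqrt n := by ring

/-- **Non-freezing from a log-floor.** If at separation `(log β)² ≤ a n` some pair correlation is `≥ c β^{−p}`
(all large `β`, every large torus), then no `(C, μ > 0)` clusters the plaquette field at all large `β`: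
`C e^{−μ n} β^p ≤ C exp(p√a √n − μ n) < c` once `n ≥ N₀`, which `β ≥ exp(√(a N₀))` forces. -/
theorem latticeNonFreezing_of_logFloor (hW : LogFloorWitness) : LatticeNonFreezing := by
  intro G _ _ _ _ hG
  letI : MeasurableSpace G := borel G
  haveI : BorelSpace G := ⟨rfl⟩
  intro r C μ hμ
  obtain ⟨p, a, c, ha, hc, β₁, hβ₁⟩ := hW G hG r
  obtain ⟨N₀, hN₀⟩ := exists_nat_exp_sqrt_sub_lt C ((p : ℝ) * Real.sqrt a) μ c (by positivity) hμ hc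
  refine ⟨max β₁ (max 1 (Real.exp (Real.sqrt (a * N₀)))), fun β hβ => ?_⟩
  have hβ₁' : β₁ ≤ β := le_trans (le_max_left _ _) hβ
  have hβ1 : 1 ≤ β := le_trans (le_trans (le_max_left _ _) (le_max_right _ _)) hβ
  have hβE : Real.exp (Real.sqrt (a * N₀)) ≤ β :=
    le_trans (le_trans (le_max_right _ _) (le_max_right _ _)) hβ
  have hβpos : 0 < β := lt_of_lt_of_le one_pos hβ1
  obtain ⟨S₁, hS₁⟩ := hβ₁ β hβ₁'
  refine ⟨S₁, fun S hS => ?_⟩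
  obtain ⟨n, y, hsep, hnS, hy, hfloor⟩ := hS₁ S hS
  refine ⟨n, y, hnS, hy, ?_⟩
  -- `N₀ ≤ n` from `a N₀ ≤ (log β)² ≤ a n`
  have hNn : N₀ ≤ n := by
    have hl : Real.sqrt (a * N₀) ≤ Real.log β := by
      have := Real.log_le_log (Real.exp_pos _) hβE
      rwa [Real.log_exp] at this
    have hl0 : 0 ≤ Real.sqrt (a * N₀) := Real.sqrt_nonneg _
    have h1 : a * N₀ ≤ Real.log β ^ 2 := by
      have h2 : Real.sqrt (a * N₀) ^ 2 ≤ Real.log β ^ 2 := pow_le_pow_left₀ hl0 hl 2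
      rwa [Real.sq_sqrt (by positivity)] at h2
    have h3 : a * N₀ ≤ a * n := le_trans h1 hsep
    have h4 : (N₀ : ℝ) ≤ n := le_of_mul_le_mul_left h3 ha
    exact_mod_cast h4
  have hmain : C * Real.exp ((p : ℝ) * Real.sqrt a * Real.sqrt n - μ * n) < c := hN₀ n hNn
  have hβp : β ^ p ≤ Real.exp ((p : ℝ) * Real.sqrt a * Real.sqrt n) := pow_le_exp_sqrt hβ1 ha.le hsep
  have hβppos : 0 < β ^ p := pow_pos hβpos p
  generalize hX : |latticeConnectedCorr r.ρ β (2 * S + 1) r.curvature.F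
      (fun U => r.curvature.F (configShift (-y) U)) n| = X at hfloor ⊢
  by_contra hcon
  push Not at hcon
  have h1 : c ≤ β ^ p * (C * Real.exp (-(μ * n))) :=
    hfloor.trans (mul_le_mul_of_nonneg_left hcon hβppos.le)
  have hsplit : Real.exp ((p : ℝ) * Real.sqrt a * Real.sqrt n - μ * n)
      = Real.exp ((p : ℝ) * Real.sqrt a * Real.sqrt n) * Real.exp (-(μ * n)) := by
    rw [← Real.exp_add]; ring_nf
  rcases le_or_gt 0 C with hC | hC
  · have hCe : 0 ≤ C * Real.exp (-(μ * n)) := mul_nonneg hC (Real.exp_pos _).le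
    have h2 : β ^ p * (C * Real.exp (-(μ * n)))
        ≤ Real.exp ((p : ℝ) * Real.sqrt a * Real.sqrt n) * (C * Real.exp (-(μ * n))) :=
      mul_le_mul_of_nonneg_right hβp hCe
    have h3 : Real.exp ((p : ℝ) * Real.sqrt a * Real.sqrt n) * (C * Real.exp (-(μ * n)))
        = C * Real.exp ((p : ℝ) * Real.sqrt a * Real.sqrt n - μ * n) := by
      rw [hsplit]; ring
    linarith
  · have hCe : C * Real.exp (-(μ * n)) < 0 := mul_neg_of_neg_of_pos hC (Real.exp_pos _)
    have h2 : β ^ p * (C * Real.exp (-(μ * n))) < 0 := mul_neg_of_pos_of_neg hβppos hCe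
    linarith

/-- **Composition**: the smeared log-floor forces lattice non-freezing. -/
theorem latticeNonFreezing_of_smearedLogFloor (hW : SmearedLogFloorWitness) : LatticeNonFreezing :=
  latticeNonFreezing_of_logFloor (logFloorWitness_of_smearedLog hW)

/-! ### The polynomial-separation node implies the log-separation node -/

/-- For a natural `n ≥ 1`: `log n ≤ 2 √n` (from `log x ≤ x − 1` at `x = √n`). -/
theorem log_nat_le_two_sqrt {n : ℕ} (hn : 1 ≤ n) : Real.log n ≤ 2 * Real.sqrt n := by
  have hnpos : (0 : ℝ) < n := by exact_mod_cast hn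
  have hs : 0 < Real.sqrt n := Real.sqrt_pos.mpr hnpos
  have h1 : Real.log (Real.sqrt n) ≤ Real.sqrt n - 1 := Real.log_le_sub_one_of_pos hs
  have h2 : Real.log n = 2 * Real.log (Real.sqrt n) := by
    conv_lhs => rw [← Real.mul_self_sqrt hnpos.le]
    rw [Real.log_mul hs.ne' hs.ne']; ring
  rw [h2]; linarith

/-- **The session-6 node implies the session-9 node**: polynomial separation `β ≤ n^k` gives
`(log β)² ≤ (4k²+1)·n`, so `latticeNonFreezing_of_logFloor` is the stronger criterion. -/
theorem logFloorWitness_of_polynomialFloor (hW : PolynomialFloorWitness) : LogFloorWitness := by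
  intro G _ _ _ _ hG
  letI : MeasurableSpace G := borel G
  haveI : BorelSpace G := ⟨rfl⟩
  intro r
  obtain ⟨k, p, c, hc, β₁, hβ₁⟩ := hW G hG r
  refine ⟨p, 4 * (k : ℝ) ^ 2 + 1, c, by positivity, hc, max β₁ 2, fun β hβ => ?_⟩
  have hβ₁' : β₁ ≤ β := le_trans (le_max_left _ _) hβ
  have hβ2 : 2 ≤ β := le_trans (le_max_right _ _) hβ
  have hβ1 : 1 ≤ β := by linarith
  obtain ⟨S₁, hS₁⟩ := hβ₁ β hβ₁'
  refine ⟨S₁, fun S hS => ?_⟩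
  obtain ⟨n, y, hsep, hnS, hy, hfloor⟩ := hS₁ S hS
  refine ⟨n, y, ?_, hnS, hy, hfloor⟩
  -- n ≥ 1 (else n^k ≤ 1 < 2 ≤ β)
  have hn1 : 1 ≤ n := by
    by_contra h0
    push Not at h0
    have : n = 0 := by omega
    subst this
    have : (β : ℝ) ≤ 1 := by
      rcases Nat.eq_zero_or_pos k with hk | hk
      · simp [hk] at hsep; exact hsep
      · simp [zero_pow hk.ne'] at hsep; linarith
    linarith
  have hnpos : (0 : ℝ) < n := by exact_mod_cast hn1
  have hlogβ0 : 0 ≤ Real.log β := Real.log_nonneg hβ1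
  have hlogβ : Real.log β ≤ k * Real.log n := by
    have := Real.log_le_log (by linarith) hsep
    rwa [Real.log_pow] at this
  have hlogn : Real.log n ≤ 2 * Real.sqrt n := log_nat_le_two_sqrt hn1
  have hk0 : (0 : ℝ) ≤ k := Nat.cast_nonneg k
  have h1 : Real.log β ≤ 2 * k * Real.sqrt n := by
    calc Real.log β ≤ k * Real.log n := hlogβ
      _ ≤ k * (2 * Real.sqrt n) := mul_le_mul_of_nonneg_left hlogn hk0
      _ = 2 * k * Real.sqrt n := by ring
  have h2 : Real.log β ^ 2 ≤ (2 * k * Real.sqrt n) ^ 2 := pow_le_pow_left₀ hlogβ0 h1 2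
  have h3 : (2 * k * Real.sqrt n) ^ 2 = 4 * (k : ℝ) ^ 2 * n := by
    rw [mul_pow, Real.sq_sqrt hnpos.le]; ring
  have hnn : (0 : ℝ) ≤ n := hnpos.le
  calc Real.log β ^ 2 ≤ 4 * (k : ℝ) ^ 2 * n := h3 ▸ h2
    _ ≤ (4 * (k : ℝ) ^ 2 + 1) * n := by nlinarith

/-- The robust criterion as a named implication. -/
def NonFreezingLogFloorCriterion : Prop := SmearedLogFloorWitness → LatticeNonFreezing

/-- `NonFreezingLogFloorCriterion` holds. -/
theorem NonFreezingLogFloorCriterion_holds : NonFreezingLogFloorCriterion :=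
  latticeNonFreezing_of_smearedLogFloor

end Summit.QuantumFields.YangMills.Theorems

end
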